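/-
Copyright (c) 2026 the pub-hodgecm-mathlib formalisation cell (harness21).  Prover seat hodgecm-mathlib-K2E1-p15 (g0), Track B ∕ K2-LIT «5Res (d)», h413 = `stmt-HodgeConjecture-24833`,
line `K2_E1_TraceFormulaBeta`, route of record `HCCMUnconditional`; dealer K2E1-plan (g7) deal (a) 13:43:37Z: the (d)-block «no pole off the real axis» at M1, LETTER-FREE modulo the
self-dual Maass–Selberg relation `h4` — ★ p860705's per-point families at level `T = 1` ∘ ★ p859884 ∕ ★ p860112 (both quadrants) ∘ density + continuity.
-/
import Summits.HodgeConjecture.HodgeConjecture.Theorems.K2E1ChiEisensteinPerPointFamilyM1CMTwo       -- ★ p860705 (this seat): `chiEisenstein_perPoint_family_maximalLevel_cm_two`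
import Summits.HodgeConjecture.HodgeConjecture.Theorems.K2E1ChiScatteringStripBoundM1CMTwo          -- ★ p860603 (this seat): brings ★ p859884 ∕ p860112 `_of_truncatedFamily[_lower]_on'`, ★ Models helpers
import HarnessLib

/-!
# K2·E1 — `K2E1ChiEisensteinPoleExclusionM1CMTwo`: NO POLE OFF THE REAL AXIS FOR THE M1 FAMILIES, LETTER-FREE MODULO `h4` — at every `z₁` with `½ < Re z₁`, `Im z₁ ≠ 0` the
# continued scattering vector `ψ` is BOUNDED on a punctured neighbourhood (`U(1,1)_{L∕L⁺}`)

Track B ∕ K2-LIT, crux h413 = `stmt-HodgeConjecture-24833`; cell `hodgecm-mathlib`, squad K2, ENGINE E1; dealer K2E1-plan (g7) (a) 13:43:37Z.  THEOREMS ONLY (no `def`, no `instance`, no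
notation, no named-fact hypothesis, no `sorry`); lane `--kind proof --supports stmt-HodgeConjecture-24833 --as helper` (count-neutral).  Closes no socket.

WHAT ([MoeglinWaldspurger1995, IV.1.11, IV.3.12 (a)]).  ★ p860705 gives, for the M1 families, ONE countable set `S ⊇ P` off which every `z ∈ {½ < Re} ∖ ℝ` carries a quadrant domain
`D₁ ∋ z` with sub-tube boxes and a continued truncated family at level `T = 1`.  For self-dual Maass–Selberg data (`v ∈ V ∖ 0`, `ψ : ℂ → V` holomorphic off `P`, the relation `h4` of
★ row 14 FILE 1 at `T = 1` in the self-dual brackets, for the M1 section `φ` itself), ★ p859884 ∕ ★ p860112 (`_of_truncatedFamily[_lower]_on'` at the brackets of ★ Models) give the (a2) box bound for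
`κm‖ψ z‖²` at every such `z`; near `z₁` (`½ < Re z₁`, `Im z₁ ≠ 0`) the box `[d∕2, 3d∕2] × {|Im| ≥ |Im z₁|∕2}` makes the bound UNIFORM, so `‖ψ z‖ ≤ C(z₁)` for `z ∉ S` in a punctured
disc; `P` is co-discrete and `ψ` is continuous off `P`, and `S` is countable (every point is a limit of non-`S` points along a horizontal segment), so the bound holds on a full
punctured neighbourhood of `z₁` — the input of ★ (L4) Riemann ∕ ★ p860014 §3 (`analyticAt_of_sq_le_bracket`): NO POLE OFF THE REAL AXIS.
* `exists_seq_tendsto_not_mem_of_countable` (density along a horizontal segment), **`chiEisenstein_noComplexPole_maximalLevel_cm_two`** (the M1 print's binders ⟹ `∃ q Ec qc P`,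
  (E1)–(E4) VERBATIM `∧ ∀ self-dual data (… h4 at T = 1 …), ∀ z₁, ½ < Re z₁ → Im z₁ ≠ 0 → ∃ C, ∀ᶠ z in 𝓝[≠] z₁, ‖ψ z‖ ≤ C`).

HONEST LABEL: HC_CM is proved only modulo the 7 printed citations (2 remaining named inputs: hLiu418 = `stmt-HodgeConjecture-24832`, h413 = `stmt-HodgeConjecture-24833`) until rung 0
closes; this file asserts no named fact and closes no socket; letter-free except the M1 condition `hφinf` and the self-dual relation `h4` quantified in the conclusion.

## References
* [MoeglinWaldspurger1995] C. Mœglin, J.-L. Waldspurger, *Spectral decomposition and Eisenstein series* (1995), IV.1.9, IV.1.11, IV.3.12 (a).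
* [BernsteinLapid2019] J. Bernstein, E. Lapid, *On the meromorphic continuation of Eisenstein series*, J. AMS 37 (2024), Thm 2.3, §4.
* [Arthur1980TraceFormulaII] J. Arthur, *A trace formula for reductive groups II*, Compositio Math. 40 (1980), §4.
-/

set_option autoImplicit false
set_option linter.dupNamespace false  -- the mandated namespace repeats the summit's segment (`HodgeConjecture.HodgeConjecture`)

noncomputable section

open MeasureTheory Measure Filter Topology Set NumberField IsDedekindDomain Metric
open scoped NNReal ENNReal ComplexConjugate InnerProductSpace
open Literature.MeasureTheory.Group Literature.NumberTheory Literature.NumberTheory.Automorphic Literature.NumberTheory.Automorphic.UnitaryGroup AdelicGroupData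
open Literature.NumberTheory.GaloisRepresentations (HeckeCharacter)
open Summit.HodgeConjecture.HodgeConjecture.Cruxes.H413.K2E1BorelEisensteinU
open Summit.HodgeConjecture.HodgeConjecture.Cruxes.H413.K2E1BLBorelSpacesU2Defs
open Summit.HodgeConjecture.HodgeConjecture.Cruxes.H413.K2E1BLBorelOperatorsU2Defs
open Summit.HodgeConjecture.HodgeConjecture.Cruxes.H413.K2E1CharacterEisensteinU2Defs
open Summit.HodgeConjecture.HodgeConjecture.Cruxes.H413.K2E1ChiSectionSpaceU2Defs
open Summit.HodgeConjecture.HodgeConjecture.Cruxes.H413.K2E1ChiMaassSelbergContinuedModelsCMTwo (real_mul_inner_self differentiableOn_inner_conj_comp norm_sq_real_mul_inner_le)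
open Summit.HodgeConjecture.HodgeConjecture.Cruxes.H413.K2E1ChiMaassSelbergContinuedOnBoxesCMTwo (poleControl_continued_chi_cm_two_of_truncatedFamily_on')
open Summit.HodgeConjecture.HodgeConjecture.Cruxes.H413.K2E1ChiMaassSelbergContinuedLowerCMTwo (poleControl_continued_chi_cm_two_of_truncatedFamily_lower_on')
open Summit.HodgeConjecture.HodgeConjecture.Cruxes.H413.K2E1ChiEisensteinPerPointFamilyM1CMTwo (chiEisenstein_perPoint_family_maximalLevel_cm_two)

namespace Summit.HodgeConjecture.HodgeConjecture.Cruxes.H413.K2E1ChiEisensteinPoleExclusionM1CMTwo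

/-- **EVERY POINT IS A LIMIT OF POINTS AVOIDING A COUNTABLE SET** (along the horizontal segment `z + δ`, `δ ↓ 0`; countable sets are Lebesgue-null). [folklore] -/
theorem exists_seq_tendsto_not_mem_of_countable {S : Set ℂ} (hS : S.Countable) (z : ℂ) :
    ∃ u : ℕ → ℂ, (∀ k, u k ∉ S) ∧ Tendsto u atTop (𝓝 z) := by
  classical
  have hinj : Function.Injective fun δ : ℝ => z + (δ : ℂ) := fun a b hab => by exact_mod_cast add_left_cancel hab
  have hcount : ((fun δ : ℝ => z + (δ : ℂ)) ⁻¹' S).Countable := hS.preimage_of_injOn hinj.injOn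
  have hgood : ∀ ε : ℝ, 0 < ε → ∃ δ : ℝ, 0 < δ ∧ δ < ε ∧ z + (δ : ℂ) ∉ S := by
    intro ε hε
    by_contra h
    push Not at h
    have hsub : Set.Ioo (0 : ℝ) ε ⊆ (fun δ : ℝ => z + (δ : ℂ)) ⁻¹' S := fun δ hδ => h δ hδ.1 hδ.2
    have h0 : volume (Set.Ioo (0 : ℝ) ε) = 0 := measure_mono_null hsub (hcount.measure_zero volume)
    rw [Real.volume_Ioo, sub_zero, ENNReal.ofReal_eq_zero] at h0
    linarith
  choose δ hδ using fun k : ℕ => hgood (1 / ((k : ℝ) + 1)) (by positivity)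
  refine ⟨fun k => z + (δ k : ℂ), fun k => (hδ k).2.2, ?_⟩
  have hδ0 : Tendsto δ atTop (𝓝 0) :=
    squeeze_zero (fun k => (hδ k).1.le) (fun k => (hδ k).2.1.le) tendsto_one_div_add_atTop_nhds_zero_nat
  have h := ((Complex.continuous_ofReal.tendsto 0).comp hδ0).const_add z
  simpa using h

variable (L : Type) [Field L] [NumberField L] [IsCMField L]
  [MeasurableSpace (quasiSplit (↥(maximalRealSubfield L)) L (IsCMField.complexConj L) 2).Adelic] [BorelSpace (quasiSplit (↥(maximalRealSubfield L)) L (IsCMField.complexConj L) 2).Adelic]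

/-- **NO POLE OFF THE REAL AXIS FOR THE M1 FAMILIES, LETTER-FREE MODULO `h4`** (module docstring). [cite: MoeglinWaldspurger1995, IV.1.11, IV.3.12 (a)] [cite: BernsteinLapid2019, Thm 2.3, §4]
[cite: Arthur1980TraceFormulaII, §4] -/
theorem chiEisenstein_noComplexPole_maximalLevel_cm_two
    (μ : Measure (quasiSplit (↥(maximalRealSubfield L)) L (IsCMField.complexConj L) 2).automorphicQuotient) [(quasiSplit (↥(maximalRealSubfield L)) L (IsCMField.complexConj L) 2).IsAutomorphicMeasure μ]
    (νG : Measure (quasiSplit (↥(maximalRealSubfield L)) L (IsCMField.complexConj L) 2).Adelic) [νG.IsHaarMeasure] [νG.IsInvInvariant] [SFinite νG]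
    (ν : Measure ↥(adelicUnipotent (↥(maximalRealSubfield L)) L (IsCMField.complexConj L) 2)) [ν.IsHaarMeasure] [ν.IsMulRightInvariant] [ν.IsInvInvariant]
    {𝓕 : Set ↥(adelicUnipotent (↥(maximalRealSubfield L)) L (IsCMField.complexConj L) 2)}
    (h𝓕N : IsFundamentalDomain ↥(rationalUnipotent (↥(maximalRealSubfield L)) L (IsCMField.complexConj L) 2) 𝓕 ν) (h𝓕c : IsCompact (closure 𝓕)) (h𝓕₀ : ν 𝓕 ≠ 0)
    {β : (quasiSplit (↥(maximalRealSubfield L)) L (IsCMField.complexConj L) 2).Adelic → ℝ≥0∞}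
    (hβ : IsCoveringWeight ↥((arithmeticBorel (↥(maximalRealSubfield L)) L (IsCMField.complexConj L) 2).map (quasiSplit (↥(maximalRealSubfield L)) L (IsCMField.complexConj L) 2).arithmeticSubgroup.subtype) β)
    {μZ : Measure (borelQuotient (↥(maximalRealSubfield L)) L (IsCMField.complexConj L) 2)} [SFinite μZ]
    (hμZ : ∀ f : borelQuotient (↥(maximalRealSubfield L)) L (IsCMField.complexConj L) 2 → ℝ≥0∞, Measurable f → ∫⁻ z, f z ∂μZ = ∫⁻ g, β g * f (toBorelQuotient (↥(maximalRealSubfield L)) L (IsCMField.complexConj L) 2 g) ∂νG)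
    -- the M1 family: `φ ∈ V(χ, K, 1)` continuous bounded with `φ ∘ ι_∞ = φ(1)`, and a basis of `V(χʷ, K, 1)` by continuous bounded functions
    {χ : HeckeCharacter L} {φ : (quasiSplit (↥(maximalRealSubfield L)) L (IsCMField.complexConj L) 2).Adelic → ℂ} (hφV : φ ∈ chiSectionSpace χ ((standardMaximalCompactGL 2 L).comap (adelicVal (↥(maximalRealSubfield L)) L (IsCMField.complexConj L) 2 ((StdForm.antidiagonal 2).over L)) : Subgroup (quasiSplit (↥(maximalRealSubfield L)) L (IsCMField.complexConj L) 2).Adelic) (fun _ => 1)) (hφc : Continuous φ) {Mφ : ℝ} (hφM : ∀ x, ‖φ x‖ ≤ Mφ)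
    (hφinf : ∀ a : arch (↥(maximalRealSubfield L)) L (IsCMField.complexConj L) 2 ((StdForm.antidiagonal 2).over L), φ (archToAdelic (↥(maximalRealSubfield L)) L (IsCMField.complexConj L) 2 _ a) = φ 1)
    {ι' : Type} [Fintype ι'] [DecidableEq ι'] (bV : Module.Basis ι' ℂ ↥(chiSectionSpace (reflectChar (IsCMField.complexConj L) χ) ((standardMaximalCompactGL 2 L).comap (adelicVal (↥(maximalRealSubfield L)) L (IsCMField.complexConj L) 2 ((StdForm.antidiagonal 2).over L)) : Subgroup (quasiSplit (↥(maximalRealSubfield L)) L (IsCMField.complexConj L) 2).Adelic) (fun _ => 1)))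
    (hbc : ∀ j, Continuous ((bV j : ↥(chiSectionSpace (reflectChar (IsCMField.complexConj L) χ) ((standardMaximalCompactGL 2 L).comap (adelicVal (↥(maximalRealSubfield L)) L (IsCMField.complexConj L) 2 ((StdForm.antidiagonal 2).over L)) : Subgroup (quasiSplit (↥(maximalRealSubfield L)) L (IsCMField.complexConj L) 2).Adelic) (fun _ => 1))) : (quasiSplit (↥(maximalRealSubfield L)) L (IsCMField.complexConj L) 2).Adelic → ℂ)) {Mb : ℝ} (hbM : ∀ j x, ‖((bV j : ↥(chiSectionSpace (reflectChar (IsCMField.complexConj L) χ) ((standardMaximalCompactGL 2 L).comap (adelicVal (↥(maximalRealSubfield L)) L (IsCMField.complexConj L) 2 ((StdForm.antidiagonal 2).over L)) : Subgroup (quasiSplit (↥(maximalRealSubfield L)) L (IsCMField.complexConj L) 2).Adelic) (fun _ => 1))) : (quasiSplit (↥(maximalRealSubfield L)) L (IsCMField.complexConj L) 2).Adelic → ℂ) x‖ ≤ Mb) :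
    ∃ (q : ι' → ℂ → ℂ) (Ec : ℂ → (quasiSplit (↥(maximalRealSubfield L)) L (IsCMField.complexConj L) 2).Adelic → ℂ) (qc : ι' → ℂ → ℂ) (P : Set ℂ),
      (∀ j, DifferentiableOn ℂ (q j) {z : ℂ | 1 < z.re}) ∧
      (∀ z : ℂ, 1 < z.re → (∑ j, q j z • ((bV j : ↥(chiSectionSpace (reflectChar (IsCMField.complexConj L) χ) ((standardMaximalCompactGL 2 L).comap (adelicVal (↥(maximalRealSubfield L)) L (IsCMField.complexConj L) 2 ((StdForm.antidiagonal 2).over L)) : Subgroup (quasiSplit (↥(maximalRealSubfield L)) L (IsCMField.complexConj L) 2).Adelic) (fun _ => 1))) : (quasiSplit (↥(maximalRealSubfield L)) L (IsCMField.complexConj L) 2).Adelic → ℂ)) = ((((ν 𝓕).toReal⁻¹ : ℝ)) : ℂ) • (fun g : (quasiSplit (↥(maximalRealSubfield L)) L (IsCMField.complexConj L) 2).Adelic => (∫ v : ↥(adelicUnipotent (↥(maximalRealSubfield L)) L (IsCMField.complexConj L) 2), flatSectionU φ z ((quasiSplit (↥(maximalRealSubfield L)) L (IsCMField.complexConj L)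 2).toAdelic (weylLongU ((IsCMField.complexConj L : L ≃ₐ[↥(maximalRealSubfield L)] L) : L →+* L) (rfl : (StdForm.antidiagonal 2).over L = (StdForm.antidiagonal 2).over L)) * ((v : (quasiSplit (↥(maximalRealSubfield L)) L (IsCMField.complexConj L) 2).Adelic) * g)) ∂ν) * (((borelHeight g : ℝ) : ℂ) ^ (z - 1)))) ∧
      (∀ g, MeromorphicNFOn (fun z => Ec z g) univ) ∧ (∀ j, MeromorphicNFOn (qc j) univ) ∧
      (∀ z : ℂ, 1 < z.re → Ec z = eisensteinSeriesU (flatSectionU φ z)) ∧ (∀ j (z : ℂ), 1 < z.re → qc j z = q j z) ∧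
      IsClosed P ∧ (∀ z₀ : ℂ, ∀ᶠ s in 𝓝[≠] z₀, s ∉ P) ∧ (∀ z ∈ P, z.re ≤ 1) ∧
      (∀ g (z : ℂ), z ∉ P → AnalyticAt ℂ (fun z => Ec z g) z) ∧ (∀ j (z : ℂ), z ∉ P → AnalyticAt ℂ (qc j) z) ∧
      (∀ g, DifferentiableOn ℂ (fun z => Ec z g) Pᶜ) ∧ (∀ j, DifferentiableOn ℂ (qc j) Pᶜ) ∧
      (∀ z : ℂ, z ∉ P → Continuous (Ec z)) ∧
      ∀ {V : Type} [NormedAddCommGroup V] [InnerProductSpace ℂ V] {cμ K κ m : ℝ}, 0 < cμ → 0 < K → 0 < κ → 0 < m →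
        ∀ {v : V}, v ≠ 0 → ∀ (ψ : ℂ → V), DifferentiableOn ℂ ψ Pᶜ →
        (∀ z z' : ℂ, 1 < z'.re → z'.re < z.re →
          ∫ x, (quasiSplit (↥(maximalRealSubfield L)) L (IsCMField.complexConj L) 2).quotFun (truncation ν 𝓕 1 (eisensteinSeriesU (flatSectionU φ z))) x *
              conj ((quasiSplit (↥(maximalRealSubfield L)) L (IsCMField.complexConj L) 2).quotFun (truncation ν 𝓕 1 (eisensteinSeriesU (flatSectionU φ z'))) x) ∂μ =
          ((cμ : ℝ) : ℂ) * (((K : ℝ) : ℂ) *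
            (((((1 : ℝ≥0) : ℝ) : ℂ) ^ (z + conj z' - 1) / (z + conj z' - 1)) * (((κ : ℝ) : ℂ) * (((m : ℝ) : ℂ) * ⟪v, v⟫_ℂ))
              + ((((1 : ℝ≥0) : ℝ) : ℂ) ^ (z - conj z') / (z - conj z')) * (((κ : ℝ) : ℂ) * (((m : ℝ) : ℂ) * ⟪ψ z', v⟫_ℂ))
              - ((((1 : ℝ≥0) : ℝ) : ℂ) ^ (-(z - conj z')) / (z - conj z')) * (((κ : ℝ) : ℂ) * (((m : ℝ) : ℂ) * ⟪v, ψ z⟫_ℂ))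
              - ((((1 : ℝ≥0) : ℝ) : ℂ) ^ (-(z + conj z' - 1)) / (z + conj z' - 1)) * (((κ : ℝ) : ℂ) * (((m : ℝ) : ℂ) * ⟪ψ z', ψ z⟫_ℂ))))) →
        ∀ z₁ : ℂ, 1 / 2 < z₁.re → z₁.im ≠ 0 → ∃ C : ℝ, ∀ᶠ z in 𝓝[≠] z₁, ‖ψ z‖ ≤ C := by
  classical
  obtain ⟨q, Ec, qc, P, hq, hqφ, h1, h2, hE1, hqcq, hPc, hPcd, hPre, hEan, hqan, hEdiff, hqdiff, hEcont, S, hSc, hPS, hpt⟩ :=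
    chiEisenstein_perPoint_family_maximalLevel_cm_two L μ νG ν h𝓕N h𝓕c h𝓕₀ hβ hμZ hφV hφc hφM hφinf bV hbc hbM
  refine ⟨q, Ec, qc, P, hq, hqφ, h1, h2, hE1, hqcq, hPc, hPcd, hPre, hEan, hqan, hEdiff, hqdiff, hEcont, ?_⟩
  intro V _ _ cμ K κ m hcμ hK hκ hm v hv ψ hψ h4 z₁ hz₁ hzim
  have hvn : 0 < ‖v‖ := norm_pos_iff.2 hv
  have ha : 0 < κ * m * ‖v‖ ^ 2 := by positivity
  have hkm : 0 < κ * m := mul_pos hκ hm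
  -- the box around `z₁`
  set d : ℝ := z₁.re - 1 / 2 with hd
  have hd0 : 0 < d := by rw [hd]; linarith
  have him0 : 0 < |z₁.im| := abs_pos.2 hzim
  set r : ℝ := min d |z₁.im| / 2 with hr
  have hr0 : 0 < r := by rw [hr]; positivity
  set η : ℝ := |z₁.im| / 2 with hη
  have hη0 : 0 < η := by rw [hη]; positivity
  set BOX : ℝ := (3 * d / 2) * ((1 : ℝ≥0) : ℝ) ^ (2 * (3 * d / 2)) * Real.sqrt (κ * m * ‖v‖ ^ 2) / η +
    Real.sqrt ((3 * d / 2) ^ 2 * ((1 : ℝ≥0) : ℝ) ^ (4 * (3 * d / 2)) * (κ * m * ‖v‖ ^ 2) / η ^ 2 + (κ * m * ‖v‖ ^ 2) * ((1 : ℝ≥0) : ℝ) ^ (4 * (3 * d / 2))) with hBOX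
  set C : ℝ := Real.sqrt (BOX ^ 2 / (κ * m)) with hC
  -- the bound at every good point of the disc
  have hgood : ∀ z : ℂ, z ∉ S → ‖z - z₁‖ < r → ‖ψ z‖ ≤ C := by
    intro z hzS hz
    have hre : |z.re - z₁.re| < r := lt_of_le_of_lt (by simpa only [Complex.sub_re] using Complex.abs_re_le_norm (z - z₁)) hz
    have him : |z.im - z₁.im| < r := lt_of_le_of_lt (by simpa only [Complex.sub_im] using Complex.abs_im_le_norm (z - z₁)) hz
    have hrd : r ≤ d / 2 := by rw [hr]; exact div_le_div_of_nonneg_right (min_le_left _ _) (by norm_num)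
    have hri : r ≤ |z₁.im| / 2 := by rw [hr]; exact div_le_div_of_nonneg_right (min_le_right _ _) (by norm_num)
    rw [abs_lt] at hre
    have hzre : 1 / 2 < z.re := by rw [hd] at hrd; linarith
    have hzim' : z.im ≠ 0 := by
      intro h0
      rw [h0, zero_sub, abs_neg] at him
      linarith
    have hηz : η ≤ |z.im| := by
      have := abs_sub_abs_le_abs_sub z₁.im z.im
      rw [abs_sub_comm] at this
      rw [hη]; linarith
    obtain ⟨D₁, O₁, O₂', Fam', hD₁, hD₁c, hD₁sub, hO₁, hO₁ne, hO₁D, hO₂', hO₂'ne, hO₂'D, hsep, hzD, hDP, hFd, hFtube⟩ :=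
      hpt 1 le_rfl z hzre hzim' hzS
    have hψD : DifferentiableOn ℂ ψ D₁ := hψ.mono hDP
    -- the self-dual brackets
    have hB₂ : DifferentiableOn ℂ (fun w : ℂ => ((κ : ℝ) : ℂ) * (((m : ℝ) : ℂ) * ⟪ψ (conj w), v⟫_ℂ)) {w : ℂ | conj w ∈ D₁} :=
      ((differentiableOn_inner_conj_comp hD₁ hψD v).const_mul _).const_mul _
    have hB₃ : DifferentiableOn ℂ (fun z : ℂ => ((κ : ℝ) : ℂ) * (((m : ℝ) : ℂ) * ⟪v, ψ z⟫_ℂ)) D₁ :=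
      (((innerSL ℂ v).differentiable.comp_differentiableOn hψD).const_mul _).const_mul _
    have hB₃₂ : ∀ z ∈ D₁, ((κ : ℝ) : ℂ) * (((m : ℝ) : ℂ) * ⟪v, ψ z⟫_ℂ) = conj (((κ : ℝ) : ℂ) * (((m : ℝ) : ℂ) * ⟪ψ z, v⟫_ℂ)) := fun z _ => by
      rw [map_mul, map_mul, Complex.conj_ofReal, Complex.conj_ofReal, inner_conj_symm]
    have hB₄₁ : ∀ z' ∈ D₁, DifferentiableOn ℂ (fun z : ℂ => ((κ : ℝ) : ℂ) * (((m : ℝ) : ℂ) * ⟪ψ z', ψ z⟫_ℂ)) D₁ := fun z' _ =>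
      (((innerSL ℂ (ψ z')).differentiable.comp_differentiableOn hψD).const_mul _).const_mul _
    have hB₄₂ : ∀ z ∈ D₁, DifferentiableOn ℂ (fun w : ℂ => ((κ : ℝ) : ℂ) * (((m : ℝ) : ℂ) * ⟪ψ (conj w), ψ z⟫_ℂ)) {w : ℂ | conj w ∈ D₁} := fun z _ =>
      ((differentiableOn_inner_conj_comp hD₁ hψD (ψ z)).const_mul _).const_mul _
    -- (a2) in either quadrant at the base `T = 1`
    have h2 : ∀ {x₁ x₂ η' : ℝ}, 0 < x₁ → (z.re - 1 / 2) ∈ Set.Icc x₁ x₂ → 0 < η' → η' ≤ |z.im| →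
        κ * m * ‖ψ z‖ ^ 2 ≤ (x₂ * ((1 : ℝ≥0) : ℝ) ^ (2 * x₂) * Real.sqrt (κ * m * ‖v‖ ^ 2) / η' +
          Real.sqrt (x₂ ^ 2 * ((1 : ℝ≥0) : ℝ) ^ (4 * x₂) * (κ * m * ‖v‖ ^ 2) / η' ^ 2 + (κ * m * ‖v‖ ^ 2) * ((1 : ℝ≥0) : ℝ) ^ (4 * x₂))) ^ 2 := by
      rcases hD₁sub with hsub | hsub
      · exact (poleControl_continued_chi_cm_two_of_truncatedFamily_on' L hD₁ hD₁c hsub hO₁ hO₁ne hO₁D hO₂' hO₂'ne hO₂'D hsep μ ν 𝓕 le_rfl hcμ hK ha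
          (b := fun z => κ * m * ‖ψ z‖ ^ 2) (fun z _ => by positivity)
          (B₁ := ((κ : ℝ) : ℂ) * (((m : ℝ) : ℂ) * ⟪v, v⟫_ℂ)) (B₂ := fun z' => ((κ : ℝ) : ℂ) * (((m : ℝ) : ℂ) * ⟪ψ z', v⟫_ℂ))
          (B₃ := fun z => ((κ : ℝ) : ℂ) * (((m : ℝ) : ℂ) * ⟪v, ψ z⟫_ℂ)) (B₄ := fun z z' => ((κ : ℝ) : ℂ) * (((m : ℝ) : ℂ) * ⟪ψ z', ψ z⟫_ℂ))
          (real_mul_inner_self κ m v) hB₂ hB₃ hB₃₂ hB₄₁ hB₄₂ (fun z _ => real_mul_inner_self κ m (ψ z)) (fun z _ => norm_sq_real_mul_inner_le hκ.le hm.le (ψ z) v)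
          φ Fam' hFd (fun w hw hw1 => (hE1 w hw1) ▸ hFtube w hw hw1) h4 hzD).2.1
      · exact (poleControl_continued_chi_cm_two_of_truncatedFamily_lower_on' L hD₁ hD₁c hsub hO₁ hO₁ne hO₁D hO₂' hO₂'ne hO₂'D hsep μ ν 𝓕 le_rfl hcμ hK ha
          (b := fun z => κ * m * ‖ψ z‖ ^ 2) (fun z _ => by positivity)
          (B₁ := ((κ : ℝ) : ℂ) * (((m : ℝ) : ℂ) * ⟪v, v⟫_ℂ)) (B₂ := fun z' => ((κ : ℝ) : ℂ) * (((m : ℝ) : ℂ) * ⟪ψ z', v⟫_ℂ))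
          (B₃ := fun z => ((κ : ℝ) : ℂ) * (((m : ℝ) : ℂ) * ⟪v, ψ z⟫_ℂ)) (B₄ := fun z z' => ((κ : ℝ) : ℂ) * (((m : ℝ) : ℂ) * ⟪ψ z', ψ z⟫_ℂ))
          (real_mul_inner_self κ m v) hB₂ hB₃ hB₃₂ hB₄₁ hB₄₂ (fun z _ => real_mul_inner_self κ m (ψ z)) (fun z _ => norm_sq_real_mul_inner_le hκ.le hm.le (ψ z) v)
          φ Fam' hFd (fun w hw hw1 => (hE1 w hw1) ▸ hFtube w hw hw1) h4 hzD).2.1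
    have h := @h2 (d / 2) (3 * d / 2) η (by positivity) ⟨by rw [hd] at hrd ⊢; linarith, by rw [hd] at hrd ⊢; linarith⟩ hη0 hηz
    -- `κm‖ψ z‖² ≤ BOX²` ⟹ `‖ψ z‖ ≤ C`
    have hsq : ‖ψ z‖ ^ 2 ≤ BOX ^ 2 / (κ * m) := by
      rw [le_div_iff₀ hkm]
      calc ‖ψ z‖ ^ 2 * (κ * m) = κ * m * ‖ψ z‖ ^ 2 := by ring
        _ ≤ BOX ^ 2 := by rw [hBOX]; exact h
    calc ‖ψ z‖ = Real.sqrt (‖ψ z‖ ^ 2) := (Real.sqrt_sq (norm_nonneg _)).symm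
      _ ≤ Real.sqrt (BOX ^ 2 / (κ * m)) := Real.sqrt_le_sqrt hsq
  -- pass to the full punctured disc: off `P` eventually, `ψ` continuous there, `S` countable
  refine ⟨C, ?_⟩
  have hdisc : ∀ᶠ z in 𝓝[≠] z₁, ‖z - z₁‖ < r := by
    have : Metric.ball z₁ r ∈ 𝓝 z₁ := Metric.ball_mem_nhds z₁ hr0
    filter_upwards [mem_nhdsWithin_of_mem_nhds this] with z hz
    rwa [Metric.mem_ball, dist_eq_norm] at hz
  filter_upwards [hPcd z₁, hdisc] with z hzP hz
  -- a sequence of non-`S` points converging to `z`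
  obtain ⟨u, huS, hlim⟩ := exists_seq_tendsto_not_mem_of_countable hSc z
  have hcont : ContinuousAt ψ z := (hψ.differentiableAt (hPc.isOpen_compl.mem_nhds hzP)).continuousAt
  have hev : ∀ᶠ k in atTop, ‖ψ (u k)‖ ≤ C := by
    have hopen : IsOpen {w : ℂ | ‖w - z₁‖ < r} := isOpen_lt (continuous_id.sub continuous_const).norm continuous_const
    filter_upwards [hlim.eventually (hopen.mem_nhds hz)] with k hk
    exact hgood (u k) (huS k) hk
  exact le_of_tendsto ((hcont.tendsto.comp hlim).norm) hev

end Summit.HodgeConjecture.HodgeConjecture.Cruxes.H413.K2E1ChiEisensteinPoleExclusionM1CMTwo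

end
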